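import Mathlib
import HarnessLib
import HarnessLib.Audit
import Summits.AtomisticToContinuum.Statement
import Literature.Barriers.AtomisticToContinuum.LowTemperatureWeakAnharmonicity
import Summits.AtomisticToContinuum.FouriersLaw.Theorems.EmbeddedDrudeMourreNessUnique

/-!
Route: ScaleFreeQuarticAnchor

CLOSED (retired) 2026-08-15T13:46:30Z by operator:999:1257524 — reason: not-a-thesis: assembly does not conclude the sub-problem Statement — note: D-0027 §2.1 audit (human 2026-08-15: routes that do not decide the summit are removed): the assembly concludes `Literature.MathematicalPhysics.KineticTheory.HeatConduction.FouriersLaw`, not the sub-problem statement; a NEW conforming route may be opened from the same idea (generated `closes : … → _r. The file is kept as the record of this route; refuted decls are indexed as negative knowledge (`ledger negatives`).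

Realises idea card AtomisticToContinuum/FouriersLaw/scale-free-quartic-anchor (spine). It suffices
to show X = X_A ∧ X_η ∧ X_low ∧ X_uniq:
 X_A (AnchorFourier): the doubly-homogeneous quartic chain ⟨U = lam·q⁴/4, V = r⁴/4, γ⟩ — the T = ∞
end of the conjunct under the PROVED amplitude conjugacy κ_{lam,β}(T) = κ_{lamT,βT}(1)
(Literature.Barriers.AtomisticToContinuum.LowTemperatureWeakAnharmonicity) composed with the time
rescaling (q, p, t) ↦ (q, b·p, t/b) — has a positive Bonetto–Lebowitz–Rey-Bellet conductivity
function (clause (ii) of FouriersLawFor, i.e. OscillatorChain.HasConductivity κ with κ > 0) for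
every lam, γ > 0. By exact self-similarity (support AnchorSelfSimilarity: D_N(T, γ) = T^{1/4}·D_N(1,
γT^{-1/4})) this is a ONE-temperature statement with κ(T) = κ(1)·T^{1/4}: the whole content is one
number per lam.
 X_η (EtaContinuation, anchor stability): X_A at pinning ratio lam/β implies that the conjunct's
chain pinnedChain ω₂ lam β γ obeys Fourier's law POINTWISE at every temperature T above some T₁(ω₂,
lam, β, γ). Dictionary (supports TimeRescaling + QuarticAmplitudeScaling): pinnedChain ω₂ lam β γ at
temperature T is conjugate to the temperature-1 chain U = ηω₂Q²/2 + (lam/β)Q⁴/4, V = ηR²/2 + R⁴/4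
with friction γη^{1/2}, η = (βT)^{-1/2}, and D_N^{pinned}(T) = (βT)^{1/4}·D_N^{η}(1); T → ∞ is η →
0, a harmonic perturbation of the anchor that is small in Gibbs measure though singular at small
amplitude.
 X_low (LowTClosure, downward closure in temperature): if Fourier's law holds pointwise on a tail T
> T₁ then it holds at every T > 0 — the weakly-anharmonic / kinetic regime; NOT this card's
mechanism, filed so that the assembly is honest and as the plug-in point for kinetic-regime lines.
 X_uniq (NessUnique, the shared item stmt-AtomisticToContinuum-0741 of route FourierGreenKubo):
weak-class uniqueness of the NESS of pinnedChain.
Here 'Fourier's law holds pointwise at T for a chain P' means: ∃ k > 0, ∀ steady-state families μ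
(defined at all N, T_L, T_R > 0), ∃ D : ℕ → ℝ, (∀ N, totalCurrent(μ N (T+δ/2) (T−δ/2))/δ → D N as δ
→ 0, δ ≠ 0) ∧ D N → k as N → ∞ (written out inline in the items; see DEFINITION REQUESTS).
Lean: `AnchorFourier → EtaContinuation → LowTClosure → NessUnique →
Literature.MathematicalPhysics.KineticTheory.HeatConduction.FouriersLaw`
## Assembly
Clause (i) of FouriersLawFor from the in-tree theorem
Literature.MathematicalPhysics.KineticTheory.HeatConduction.pinnedChain_exists_isSteadyState
(Cuneo–Eckmann–Hairer–Rey-Bellet 2018 Thm 2.13, PROVED in LangevinChainNESSHolds.lean) + NessUnique;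
clause (ii): AnchorFourier at lam/β discharges the hypothesis of EtaContinuation (a tail of good
temperatures), LowTClosure extends it to all T > 0, and κ(T) := the pointwise constant
(Classical.choose; κ := 1 off (0, ∞)). Verified rc 0 by the planner (AssemblyProof.lean, axioms
propext / Classical.choice / Quot.sound; attached as evidence to the Assembly item), together with
HighTFourier = AnchorFourier + EtaContinuation (modus ponens).

Rationale: WHY THIS LINE. The conjunct's family has exactly one corner with an exact symmetry instead of a
small parameter: by the proved scaling conjugacy (AokiLukkarinenSpohn2006 §2 (2.8)–(2.13); tree:
fouriersLawFor_smul_iff, hasConductivity_of_smul) high temperature at fixed couplings is strong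
quartic coupling at temperature 1, and after the time rescaling the T = ∞ end is the
doubly-homogeneous quartic chain H₀ = Σ p²/2 + lam q⁴/4 + Σ r⁴/4, for which H₀(aq, a²p) = a⁴H₀(q,
p): every temperature and every friction is conjugate to every other (D_N(T, γ) = T^{1/4}D_N(1,
γT^{-1/4})), no near-integrable low-energy regime exists, and IF Fourier's law holds then κ₀(T) =
κ₀(1)T^{1/4} exactly (the physics-level power laws of LiLi2007/LiLi2013 and the 'purely quartic
lattice = high-T FPU' heuristic, which the literature only uses for the UNPINNED, anomalous chain).
The route is a REGIME DECOMPOSITION of the temperature axis (thought-starters 8/29/31: regime split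
+ exactly self-similar member + continuation): prove BLR's clause (ii) first for the anchor (one
temperature, one number per lam), continue it in η = (βT)^{-1/2} to a high-temperature tail of the
conjunct's chain (the harmonic terms η(ω₂Q² + R²)/2 are relevant only at amplitudes ≲ η^{1/2}, of
vanishing Gibbs weight), and glue with a downward-closure crux owning the kinetic corner. Imported
from elsewhere: nothing beyond dimensional analysis/RG language (the anchor is a renormalisation
fixed point by construction: block coarse-graining composed with the exact rescaling maps the
temperature-1 model to itself, so a multiscale proof controls ONE scale step with no running
couplings) and fixed-N NESS perturbation theory (HairerMajda2009). What it does that route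
FourierGreenKubo does not: that route is T-pointwise Green–Kubo on the conjunct's model with no
anchor and no continuation structure; here the N → ∞ difficulty is first isolated on a
parameter-free model and the T-dependence of the conjunct is organised around it. Because
FouriersLawFor bundles ALL temperatures and the η-family is self-conjugate, 'FouriersLawFor of the
η-chain for small η' would be the whole conjunct; the cut is therefore made INSIDE clause (ii),
pointwise in T — the card's crux 4 is re-typed accordingly.
RANKED CRUXES. #2 AnchorFourier — ∀ lam γ > 0 ∃ κ > 0 on (0,∞): HasConductivity ⟨lam q⁴/4, r⁴/4, γ⟩
κ (why it might fail: still a deterministic anharmonic chain with no small parameter,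
HasBoundedResponse applies squarely; a = b = 4 is the uninvestigated marginal case of the De
Roeck–Huveneers bad-transport criterion; the lam → 0 end is the anomalous unpinned quartic FPU
chain, the lam → ∞ end a DRH-type near-insulating desert, so κ₀(lam) has no uniformity; sources
BonettoLebowitzReyBellet2000 §5.3/§10, DeRoeckHuveneers2019 §3, LukkarinenSpohn2008, LiLi2013). #3
EtaContinuation — anchor conductivity at lam/β ⇒ ∃ T₁ ∀ T > T₁ pointwise Fourier for pinnedChain ω₂
lam β γ (why it might fail: the harmonic perturbation is singular at small amplitude — local
frequency at the well bottom jumps from 0 to √(ηω₂) — so rare cold regions could be non-perturbative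
Griffiths-type weak links; N-uniform response to a Hamiltonian parameter is as unavailable as any
N-uniform control; along T → ∞ at fixed γ the rescaled friction γη^{1/2} → 0 jointly; sources
AokiLukkarinenSpohn2006 §2, HairerMajda2009, CuneoEckmannHairerReyBellet2018 §2.3,
DeRoeckHuveneers2015). #4 LowTClosure — a tail of Fourier temperatures propagates to all T > 0 (why
it might fail: T → 0 is the harmonic/kinetic corner where κ ≍ (λT)⁻² is predicted and three length
scales ℓ₁ ~ (λT)⁻² ≪ ℓ₂ ~ (λT)^{-2p} appear; no monotonicity or open–closed principle for the set of
Fourier temperatures is known; an interior near-integrable window would break it; sources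
AokiLukkarinenSpohn2006 §3–4, BricmontKupiainen2007 §1, HuveneersLukkarinen2020; NOT this card's
mechanism — the honest gluing crux, shared plug for kinetic-regime cards).
KILL CRITERIA. A proof that the anchor is anomalous or insulating for some lam > 0 (¬AnchorFourier:
D_N unbounded or → 0 for ⟨lam q⁴/4, r⁴/4, γ⟩) closes the route (close --reason
refuted:AnchorFourier) and, via the conjugacy, says the conjunct's κ(T)/T^{1/4} has no finite
positive limit as T → ∞ — informative for every line. A refutation of EtaContinuation with
AnchorFourier standing (Fourier at T = ∞ but not on a high-T tail) forces a pivot to a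
non-perturbative high-T crux (file HighTFourier directly as crux). Refutation of LowTClosure by an
interior anomalous temperature refutes the conjunct itself (file ¬FouriersLaw). HighTFourier proved
elsewhere by another method moots #2–#3 for the summit (the anchor items stay as Literature-grade
targets).
NOT DECOMPOSED YET. The engine for AnchorFourier (candidates, all other cards run on the anchor
first: fekete-resistance-subadditivity / superadditive-junction-dichotomy certificates — one
parameter-free instance per lam; spatial-dynamics-slow-manifold; the porous-medium hydrodynamic
strengthening of porous-medium-anchor-barenblatt; breather-stability numbers σ(ρ), b(ρ) of
hot-spots-cold-anchor-breathers); the finiteness/positivity halves of AnchorFourier; the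
perturbation scheme of EtaContinuation (openness of the good-η set around η = 0 vs a direct
two-scale argument); uniform-in-γ thresholds (expected: T₁ = T₁(ω₂, lam, β), cf. the parity bound
|∂log D_N/∂log γ| ≤ 1 of card gamma-parity-contacts-forgotten); weak-class NESS uniqueness for the
anchor (not needed by the assembly).
CHEAPEST FALSIFIER. (a) Lookup, done: does CEHR 2018 exclude V = r⁴/4? No — arXiv:1712.09413 p.5
Example 2.5 ('V(x) = ‖x‖^r, r = 2, 4, 6, … is non-degenerate') and Example 2.8 (nearly homogeneous),
so C1–C5 hold for the anchor in print (support AnchorSteadyStateExists; the tree proof for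
pinnedChain used V″ ≠ 0 and ω₂ > 0 and must be adapted). (b) Numerics (kit, not run this session —
hub compute-free, one-shot unit): NESS of ⟨q⁴/4, r⁴/4, γ = 1⟩ at T = 1 and T = 16 must coincide
after rescaling (code/concept check) and N·J_N/δT must saturate; κ(T)/T^{1/4} = const and D_N(T, γ)
= T^{1/4}D_N(1, γT^{-1/4}) are exact identities any simulation must reproduce; a growing D_N ∝ N^α
at lam = 1 would kill #2 cheaply.
TWO-LAYER PLAN. Foreseen splits once something closes: AnchorFourier ⇐ AnchorBounded (N-uniform
upper bound on |D_N| at T = 1) → AnchorPositiveLimit (lim inf > 0 and existence of the limit, e.g.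
by quasi-sub/superadditivity of resistances) → AnchorFourier; EtaContinuation ⇐ EtaDictionary (the
conjugacy above, provable now from the two scaling supports) → EtaStability (Fourier at temperature
1 for the η-chain, η ≤ η₀(ω₂, lam/β), all frictions) → EtaContinuation; HighTFourier is the
standalone node AnchorFourier + EtaContinuation close by modus ponens (proof attached).
NUMBERS. Anchor: ⟨kinetic⟩ = 2⟨potential⟩ per degree of freedom in equilibrium (virial, degree-4
homogeneity), e(T) = ¾T; κ₀(T) = κ₀(1)T^{1/4}; D_N(T, γ) = T^{1/4}D_N(1, γT^{-1/4}); conjunct ↔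
η-chain: η = (βT)^{-1/2}, friction γ(βT)^{-1/4}, D_N^{pinned}(T) = (βT)^{1/4}D_N^{η}(1); smallness
parameters of the continuation: ω₂²/(lamT) and 1/(βT). Kinetic corner (not ours): κ ≍ C(λT)⁻²
predicted (AokiLukkarinenSpohn2006 (3.28), c(0) ≈ 0.2756).
SOURCES. BonettoLebowitzReyBellet2000 §5.3 (33), §10 item 1; AokiLukkarinenSpohn2006 §2
(2.8)–(2.13), §3; CuneoEckmannHairerReyBellet2018 Thm 2.13, Ex. 2.5/2.8, §2.3; ReyBelletThomas2002
(scaling to the homogeneous system); HairerMattingly2009; HairerMajda2009 (arXiv:0909.4313);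
DeRoeckHuveneers2019 (arXiv:1904.07742) §3; DeRoeckHuveneers2015; LiLi2007; LiLi2013;
AokiKusnezov2001; LukkarinenSpohn2008; BricmontKupiainen2007; HuveneersLukkarinen2020; LNP 921 ch. 6
(panama:228500850081808, 'purely quartic or qFPU-β lattice', unpinned).
DEFINITION REQUESTS. OscillatorChain.HasConductivityAt P T k ('Fourier's law pointwise at
temperature T with constant k', the inline clause repeated in
EtaContinuation/LowTClosure/HighTFourier) in Literature/MathematicalPhysics/KineticTheory next to
HasConductivity — filed after open; optional quarticChain lam γ / etaChain ω₂ μ η γ abbreviations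
(Summits/…/Theorems side) — not filed, anonymous constructors elaborate.
SUPPORT. NessUnique (shared stmt-0741, rank 5); HighTFourier (the card's deliverable as a standalone
node); TimeRescaling and QuarticAmplitudeScaling (provable-now conjugacies, pattern
isSteadyState_map_smul / totalCurrent_map_smul of LowTemperatureWeakAnharmonicity.lean);
AnchorSelfSimilarity (friction–temperature conjugacy of the anchor, from the two);
AnchorSteadyStateExists (CEHR Thm 2.13 instance for the anchor, print-known, de-vacuifies
AnchorFourier).

Novelty: Searches (2026-08-15, this planner): lit search --source crossref 'quartic lattice heat conduction
temperature dependence thermal conductivity homogeneous potential' (12 rows, none relevant);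
--source arxiv / s2 (HTTP 429, rate-limited, logged); lit galaxy search 'purely quartic lattice'
--star all (1 hit: LNP 921 Thermal Transport in Low Dimensions, panama:228500850081808, ch. 6: 'the
purely quartic or the qFPU-β lattice with k₂ = k₃ = 0, k₄ = 1' — UNPINNED, anomalous α ≈ 2/5, read
chars 746000–850000); lit search --hybrid local 'high temperature limit thermal conductivity pinned
anharmonic chain scaling quartic' (8 engineering books, none relevant); lit frontier
AtomisticToContinuum --since 2021 (no anchor/scaling paper among 30 descendants); lit read
arXiv:1712.09413 pp. 3–6 (CEHR C1–C5, Examples 2.5/2.8); in tree: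
Literature/Barriers/AtomisticToContinuum/LowTemperatureWeakAnharmonicity.lean (proved conjugacy),
the 100+ sibling idea cards (porous-medium-anchor-barenblatt, hot-spots-cold-anchor-breathers,
deserts-at-the-edge all BUILD ON this card's anchor; none is routed), the only other route
FourierGreenKubo. Plus the card's own audited searches (refuter novelty audit 2026-08-15T04:49Z:
LiLi2007 doi:10.1209/0295-5075/78/34001, LiLi2013 doi:10.1103/physreve.87.042125,
arXiv:cond-mat/0602082 §2, doi:10.1002/cpa.20280, arXiv:1712.09413).
Nearest prior art found: AokiLukkarinenSpohn2006 §2 (the scaling conjugacy; in tree) and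
LiLi2007/LiLi2013 (physics-level exact temperatur  [refs: 10.1209/0295-5075/78/34001, 10.1103/physreve.87.042125, 10.1002/cpa.20280, 1712.09413, cond-mat/0602082, doi:10.1209/0295-5075/78/34001, doi:10.1103/physreve.87.042125, doi:10.1002/cpa.20280, LiLi2007, LiLi2013, AokiLukkarinenSpohn2006, ReyBelletThomas2002, CuneoEckmannHairerReyBellet2018, HairerMattingly2009, DeRoeckHuveneers2019]

Barriers (technique_class: scale-invariance-anchor, continuation-in-eta, regime-decomp): - technique_class: scale-invariance-anchor, continuation-in-eta, regime-decomposition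
- Literature.Barriers.AtomisticToContinuum.LowTemperatureWeakAnharmonicity: the route is BUILT on
this entry's proved conjugacy and owns the OPPOSITE corner (lamT, βT → ∞); AnchorFourier and
EtaContinuation make no claim uniform as T → 0 (inside the anchor family there is no harmonic limit
point at all). LowTClosure does NOT evade it: it is the honest gluing crux for the kinetic corner;
the bet is only that the barrier kills T-UNIFORM bounds (κ ≍ (λT)⁻²) while LowTClosure asks
pointwise statements, which the entry's scope_caveats explicitly leave open.
- Literature.Barriers.AtomisticToContinuum.HarmonicChainBallisticFlux: not touched — the anchor has
no quadratic part; the continuation adds a SMALL harmonic part to a quartic model, the reverse of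
perturbing the ballistic harmonic chain; AnchorFourier is stated for lam > 0 and the conjunct's
parameters stay > 0 throughout.
- Literature.Barriers.AtomisticToContinuum.HasBoundedResponse: applies squarely to AnchorFourier
(hasBoundedResponse_of_fouriersLawFor: any proof must control D_N uniformly in N, which no fixed-N
tool does). It does not evade it; the bet is that the anchor is the cleanest instance on which an
N-uniform engine (resistance sub/superadditivity certificates, spatial transfer gaps, hydrodynamic
limits) can first be run: one temperature, no parameters but lam, finite computations with a single
instance, and every estimate proved

History (route lifecycle, newest last):
- 2026-08-15T13:46:30Z · CLOSED retired — not-a-thesis: assembly does not conclude the sub-problem Statement (operator:999:1257524)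

sub-problem: FouriersLaw · status: closed(retired) · opened planner-plancard-AtomisticToContinuum-Fourier-c07f6739-0 2026-08-15T11:15:16Z · rev 0 · ledger route-AtomisticToContinuum-ScaleFreeQuarticAnchor
GENERATED by the gate from the ledger (D-0016/17). Provers cite these decls: `theorem foo : Summit.AtomisticToContinuum.FouriersLaw.Theses.ScaleFreeQuarticAnchor.<Decl> := …` in Summits/AtomisticToContinuum/FouriersLaw/Theorems/<Name>.lean.
-/

namespace Summit.AtomisticToContinuum.FouriersLaw.Theses.ScaleFreeQuarticAnchor

open scoped BigOperators Topology Manifold Classical MeasureTheory ProbabilityTheory Matrix InnerProductSpace ComplexConjugate ContinuousMap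
open Filter Set Function TopologicalSpace MeasureTheory

attribute [summit_statement] _root_.FouriersLaw

/-- item stmt-AtomisticToContinuum-3279 · crux · rank 2 · closed · moot by None · by planner
why it might fail: No small parameter: N-uniform control of D_N is open for every deterministic anharmonic chain (HasBoundedResponse); a=b=4 is the uninvestigated marginal case of DRH's bad-transport criterion; lam→0 is the anomalous unpinned quartic FPU chain, lam→∞ a near-insulating desert.
sources: BonettoLebowitzReyBellet2000 §5.3 (33), §10 item 1, DeRoeckHuveneers2019 (arXiv:1904.07742) §3, LiLi2013 (doi:10.1103/physreve.87.042125), AokiKusnezov2001, LukkarinenSpohn2008, decl Literature.Barriers.AtomisticToContinuum.HasBoundedResponse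
[crux] ANCHOR FOURIER (card item 3, clause (ii) only): for the doubly-homogeneous quartic chain ⟨U =
lam q⁴/4, V = r⁴/4, friction γ⟩ with lam, γ > 0 there is κ : ℝ → ℝ, positive on (0,∞), which is a
BLR conductivity function (OscillatorChain.HasConductivity, LowTemperatureWeakAnharmonicity.lean:
for every steady-state family and every T > 0 the finite-N responses D_N = lim_{δ→0}
totalCurrent(μ_{N,T+δ/2,T−δ/2})/δ exist and D_N → κ(T)). By exact self-similarity (support
AnchorSelfSimilarity) equivalent to the single-temperature statement at T = 1 for all frictions, and
then κ(T) = κ(1)T^{1/4}. Clause (i) for the anchor is NOT included (existence = support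
AnchorSteadyStateExists, print-known; weak-class uniqueness not needed by the assembly). Why it
might fail: no small parameter; HasBoundedResponse applies; marginal a = b = 4 (DeRoeckHuveneers2019
§3); lam → 0 anomalous (unpinned quartic FPU), lam → ∞ near-insulating. Sources:
BonettoLebowitzReyBellet2000 §5.3 (33), §10 item 1; DeRoeckHuveneers2019 (arXiv:1904.07742) §3;
LiLi2013; AokiKusnezov2001; LukkarinenSpohn2008. [difficulty: open-problem] -/
@[route_item "route-AtomisticToContinuum-ScaleFreeQuarticAnchor"]
def AnchorFourier : Prop :=
  ∀ lam γ : ℝ, 0 < lam → 0 < γ → ∃ κ : ℝ → ℝ, (∀ T : ℝ, 0 < T → 0 < κ T) ∧ ∀ μ : (N : ℕ) → ℝ → ℝ → MeasureTheory.Measure (Literature.MathematicalPhysics.KineticTheory.HeatConduction.PhaseSpace N), (∀ (N : ℕ) (T_L T_R : ℝ), 0 < T_L → 0 < T_R → (⟨fun q => lam * q ^ 4 / 4, fun r => r ^ 4 / 4, γ⟩ : Literature.MathematicalPhysics.KineticTheory.HeatConduction.OscillatorChain).IsSteadyState N T_L T_R (μ N T_L T_R)) → ∀ T : ℝ, 0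 < T → ∃ D : ℕ → ℝ, (∀ N : ℕ, Filter.Tendsto (fun δ : ℝ => (⟨fun q => lam * q ^ 4 / 4, fun r => r ^ 4 / 4, γ⟩ : Literature.MathematicalPhysics.KineticTheory.HeatConduction.OscillatorChain).totalCurrent (μ N (T + δ / 2) (T - δ / 2)) / δ) (nhdsWithin 0 {(0 : ℝ)}ᶜ) (nhds (D N))) ∧ Filter.Tendsto D Filter.atTop (nhds (κ T))

/-- item stmt-AtomisticToContinuum-3280 · crux · rank 3 · closed · moot by None · by planner
why it might fail: The harmonic perturbation η(ω₂Q²+R²)/2 is singular at small amplitude (well-bottom frequency 0→√(ηω₂)): cold regions may be non-perturbative Griffiths-type weak links; N-uniform response to a Hamiltonian parameter is as unavailable as any N-uniform control; rescaled friction γη^{1/2}→0 jointly.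
sources: AokiLukkarinenSpohn2006 §2 (2.8)-(2.13), HairerMajda2009 (arXiv:0909.4313), CuneoEckmannHairerReyBellet2018 (arXiv:1712.09413) §2.3, DeRoeckHuveneers2015, decl Literature.Barriers.AtomisticToContinuum.LowTemperatureWeakAnharmonicity
[crux] ETA-CONTINUATION = ANCHOR STABILITY (card item 4, re-typed pointwise in T): for ω₂, lam, β, γ
> 0, IF the anchor at pinning ratio lam/β has a positive conductivity function for every friction γ'
(the AnchorFourier instance), THEN there is T₁ such that for every T > T₁ the conjunct's chain
pinnedChain ω₂ lam β γ obeys Fourier's law POINTWISE at T: ∃ k > 0, ∀ steady-state families μ, ∃ D,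
(∀ N, totalCurrent(μ N (T+δ/2)(T−δ/2))/δ → D N as δ → 0, δ ≠ 0) ∧ D N → k. Dictionary (supports
TimeRescaling, QuarticAmplitudeScaling): pinnedChain ω₂ lam β γ at temperature T ≅ the temperature-1
chain U = ηω₂Q²/2 + (lam/β)Q⁴/4, V = ηR²/2 + R⁴/4 with friction γη^{1/2}, η = (βT)^{-1/2},
D_N^{pinned}(T) = (βT)^{1/4} D_N^{η}(1); so the crux is stability of the anchor's Fourier package
under the harmonic perturbation η(ω₂Q² + R²)/2, relevant only at amplitudes ≲ η^{1/2} (Gibbs weight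
→ 0), along (η, friction) = (η, γη^{1/2}) → (0, 0); expected truth is uniform in γ (T₁ = T₁(ω₂, lam,
β)), the weaker pointwise form is filed. Why it might fail: singular small-amplitude perturbation
(local frequency 0 → √(ηω₂)), cold regions as Griffiths-type weak links; N-uniform
parameter-response is as unavailabl -/
@[route_item "route-AtomisticToContinuum-ScaleFreeQuarticAnchor"]
def EtaContinuation : Prop :=
  ∀ ω₂ lam β γ : ℝ, 0 < ω₂ → 0 < lam → 0 < β → 0 < γ → (∀ γ' : ℝ, 0 < γ' → ∃ κ₀ : ℝ → ℝ, (∀ T : ℝ, 0 < T → 0 < κ₀ T) ∧ ∀ μ : (N : ℕ) → ℝ → ℝ → MeasureTheory.Measure (Literature.MathematicalPhysics.KineticTheory.HeatConduction.PhaseSpace N), (∀ (N : ℕ) (T_L T_R : ℝ), 0 < T_L → 0 < T_R → (⟨fun q => lam / β * q ^ 4 / 4, fun r => r ^ 4 / 4, γ'⟩ : Literature.MathematicalPhysics.KineticTheory.HeatConduction.OscillatorChain).IsSteadyState N T_L T_R (μ N T_L T_R)) → ∀ T : ℝ, 0 < T → ∃ D : ℕ → ℝ, (∀ N : ℕ,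 Filter.Tendsto (fun δ : ℝ => (⟨fun q => lam / β * q ^ 4 / 4, fun r => r ^ 4 / 4, γ'⟩ : Literature.MathematicalPhysics.KineticTheory.HeatConduction.OscillatorChain).totalCurrent (μ N (T + δ / 2) (T - δ / 2)) / δ) (nhdsWithin 0 {(0 : ℝ)}ᶜ) (nhds (D N))) ∧ Filter.Tendsto D Filter.atTop (nhds (κ₀ T))) → ∃ T₁ : ℝ, ∀ T : ℝ, T₁ < T → ∃ k : ℝ, 0 < k ∧ ∀ μ : (N : ℕ) → ℝ → ℝ → MeasureTheory.Measure (Literature.MathematicalPhysics.KineticTheory.HeatConduction.PhaseSpace N), (∀ (N : ℕ) (T_L T_R : ℝ), 0 < T_L → 0 < T_R → (Literature.MathematicalPhysics.KineticTheory.HeatConduction.pinnedChain ω₂ lam β γ).IsSteadyState N T_L T_R (μ N T_L T_R)) → ∃ D : ℕ → ℝ, (∀ N : ℕ, Filter.Tendsto (fun δ : ℝ => (Literature.MathematicalPhysics.KineticTheory.HeatConduction.pinnedChain ω₂ lam β γ).totalCurrent (μ N (T + δ / 2) (T - δ / 2)) / δ) (nhdsWithin 0 {(0 : ℝ)}ᶜ)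 (nhds (D N))) ∧ Filter.Tendsto D Filter.atTop (nhds k)

/-- item stmt-AtomisticToContinuum-3281 · crux · rank 4 · closed · moot by None · by planner
why it might fail: T→0 is the harmonic/kinetic corner (LowTemperatureWeakAnharmonicity: κ≍(λT)⁻² predicted, scales ℓ₁~(λT)⁻²≪ℓ₂~(λT)^{-2p}); no monotonicity/connectedness of the set of Fourier temperatures is known; an interior near-integrable window would break it.
sources: AokiLukkarinenSpohn2006 §3 (3.25)-(3.28), §4, BricmontKupiainen2007 §1, HuveneersLukkarinen2020 pp. 2-3, decl Literature.Barriers.AtomisticToContinuum.LowTemperatureWeakAnharmonicity, decl Literature.Barriers.AtomisticToContinuum.AokiLukkarinenSpohn2006_kineticLowTemperature_prediction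
[crux] DOWNWARD CLOSURE IN TEMPERATURE (card item 5, the gluing crux; NOT this card's mechanism):
for ω₂, lam, β, γ > 0, if pinnedChain ω₂ lam β γ obeys Fourier's law pointwise (same inline clause
as EtaContinuation) at every T above some T₁, then it does so at every T > 0. By the conjugacy
κ_{lam,β}(T) = κ_{lamT,βT}(1) this is propagation from strong to weak anharmonic coupling at
temperature 1, ending in the kinetic (phonon-Boltzmann) corner; strictly weaker than clause (ii)
itself (it has a hypothesis) and the natural plug-in point for kinetic-regime lines (cards
kinetic-corner-deng-hani-post-kinetic-tail, kinetic-slab-with-contacts,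
onset-of-resistance-secular-series) or for an open–closed continuation of EtaContinuation's
perturbation theory to all η with a priori bounds. Why it might fail: T → 0 is the harmonic/kinetic
corner (barrier LowTemperatureWeakAnharmonicity: κ ≍ (λT)⁻² predicted; length scales ℓ₁ ~ (λT)⁻², ℓ₂
~ (λT)^{-2p}, HuveneersLukkarinen2020); no monotonicity or connectedness principle for the set of
Fourier temperatures is known; an interior near-integrable window would break it. Sources:
AokiLukkarinenSpohn2006 §3 (3.25)–(3.28), §4; BricmontKupiainen2007 §1; H -/
@[route_item "route-AtomisticToContinuum-ScaleFreeQuarticAnchor"]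
def LowTClosure : Prop :=
  ∀ ω₂ lam β γ : ℝ, 0 < ω₂ → 0 < lam → 0 < β → 0 < γ → (∃ T₁ : ℝ, ∀ T : ℝ, T₁ < T → ∃ k : ℝ, 0 < k ∧ ∀ μ : (N : ℕ) → ℝ → ℝ → MeasureTheory.Measure (Literature.MathematicalPhysics.KineticTheory.HeatConduction.PhaseSpace N), (∀ (N : ℕ) (T_L T_R : ℝ), 0 < T_L → 0 < T_R → (Literature.MathematicalPhysics.KineticTheory.HeatConduction.pinnedChain ω₂ lam β γ).IsSteadyState N T_L T_R (μ N T_L T_R)) → ∃ D : ℕ → ℝ, (∀ N : ℕ, Filter.Tendsto (fun δ : ℝ => (Literature.MathematicalPhysics.KineticTheory.HeatConduction.pinnedChain ω₂ lam β γ).totalCurrent (μ N (T + δ / 2) (T - δ / 2)) / δ) (nhdsWithin 0 {(0 : ℝ)}ᶜ) (nhds (D N))) ∧ Filter.Tendsto D Filter.atTop (nhds k)) → ∀ T : ℝ, 0 < T → ∃ k : ℝ, 0 < k ∧ ∀ μ : (N : ℕ) → ℝ → ℝ → MeasureTheory.Measure (Literature.MathematicalPhysics.KineticTheory.HeatConduction.PhaseSpace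 N), (∀ (N : ℕ) (T_L T_R : ℝ), 0 < T_L → 0 < T_R → (Literature.MathematicalPhysics.KineticTheory.HeatConduction.pinnedChain ω₂ lam β γ).IsSteadyState N T_L T_R (μ N T_L T_R)) → ∃ D : ℕ → ℝ, (∀ N : ℕ, Filter.Tendsto (fun δ : ℝ => (Literature.MathematicalPhysics.KineticTheory.HeatConduction.pinnedChain ω₂ lam β γ).totalCurrent (μ N (T + δ / 2) (T - δ / 2)) / δ) (nhdsWithin 0 {(0 : ℝ)}ᶜ) (nhds (D N))) ∧ Filter.Tendsto D Filter.atTop (nhds k)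

/-- item stmt-AtomisticToContinuum-0741 · support · rank 5 · closed · proved by Summit.AtomisticToContinuum.FouriersLaw.Theorems.nessUnique_proof (prover) · by planner
sources: CuneoEckmannHairerReyBellet2018 Thm 2.13(1), Carmona2007 Thm 1.1(iii)
[crux] UNIQUENESS OF THE WEAK STEADY STATE (the half of stmt-0706 not covered by the landed fact
Literature.MathematicalPhysics.KineticTheory.HeatConduction.CuneoEckmannHairerReyBellet2018_pinnedChain,
p3544): for pinnedChain ω₂ lam β γ (all > 0), every N and T_L, T_R > 0, any two measures in the weak
Fokker–Planck class IsSteadyState (probability, ∫ L f dμ = 0 for f ∈ C_c^∞, bond currents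
integrable) coincide. Print: uniqueness of the INVARIANT MEASURE of the Langevin semigroup
(CuneoEckmannHairerReyBellet2018 Thm 2.13(1): C1, C2, CA; Carmona2007 Thm 1.1(iii)); the item
additionally needs 'weak stationary probability solution of L*μ = 0 ⇒ P_t-invariant' for this
hypoelliptic L with cubic drift (Echeverría 1982 well-posed martingale problem on C_c^∞ +
non-explosion via e^{θH}; Bogachev–Krylov–Röckner–Shaposhnikov 2015 Ch. 5 is non-degenerate only) —
the FP-identification lemma is the formal crux. N = 0: PhaseSpace 0 is a point (unique probability
measure); N = 1: both baths on site 0, OU at temperature (T_L+T_R)/2. This is exactly the hypothesis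
of FiniteResponse and ThermodynamicLimit and, with the fact, gives clause (i) of FouriersLawFor. -/
@[route_item "route-AtomisticToContinuum-ScaleFreeQuarticAnchor"]
def NessUnique : Prop :=
  ∀ ω₂ lam β γ : ℝ, 0 < ω₂ → 0 < lam → 0 < β → 0 < γ → ∀ (N : ℕ) (T_L T_R : ℝ), 0 < T_L → 0 < T_R → ∀ μ ν : MeasureTheory.Measure (Literature.MathematicalPhysics.KineticTheory.HeatConduction.PhaseSpace N), (Literature.MathematicalPhysics.KineticTheory.HeatConduction.pinnedChain ω₂ lam β γ).IsSteadyState N T_L T_R μ → (Literature.MathematicalPhysics.KineticTheory.HeatConduction.pinnedChain ω₂ lam β γ).IsSteadyState N T_L T_R ν → μ = ν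

/-- item stmt-AtomisticToContinuum-3282 · support · rank 9 · closed · moot by None · by planner
sources: AokiLukkarinenSpohn2006 §2, LiLi2013
[support] HIGH-TEMPERATURE FOURIER LAW, the card's deliverable as a standalone node: for ω₂, lam, β,
γ > 0 there is T₁ such that pinnedChain ω₂ lam β γ obeys Fourier's law pointwise (inline clause) at
every T > T₁. Equals AnchorFourier + EtaContinuation by modus ponens at lam/β (planner proof
attached, AssemblyProof.lean highT_of_anchor_eta); filed so that any other high-temperature method
(e.g. the porous-medium hydrodynamics of card porous-medium-anchor-barenblatt, or a direct
non-perturbative argument at large (lamT, βT)) can close the high-T half without the anchor. [deps: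
AnchorFourier, EtaContinuation] [difficulty: open-problem] -/
@[route_item "route-AtomisticToContinuum-ScaleFreeQuarticAnchor"]
def HighTFourier : Prop :=
  ∀ ω₂ lam β γ : ℝ, 0 < ω₂ → 0 < lam → 0 < β → 0 < γ → ∃ T₁ : ℝ, ∀ T : ℝ, T₁ < T → ∃ k : ℝ, 0 < k ∧ ∀ μ : (N : ℕ) → ℝ → ℝ → MeasureTheory.Measure (Literature.MathematicalPhysics.KineticTheory.HeatConduction.PhaseSpace N), (∀ (N : ℕ) (T_L T_R : ℝ), 0 < T_L → 0 < T_R → (Literature.MathematicalPhysics.KineticTheory.HeatConduction.pinnedChain ω₂ lam β γ).IsSteadyState N T_L T_R (μ N T_L T_R)) → ∃ D : ℕ → ℝ, (∀ N : ℕ, Filter.Tendsto (fun δ : ℝ => (Literature.MathematicalPhysics.KineticTheory.HeatConduction.pinnedChain ω₂ lam β γ).totalCurrent (μ N (T + δ / 2) (T - δ / 2)) / δ) (nhdsWithin 0 {(0 : ℝ)}ᶜ) (nhds (D N))) ∧ Filter.Tendsto D Filter.atTop (nhds k)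

/-- item stmt-AtomisticToContinuum-3283 · support · rank 9 · closed · moot by None · by planner
sources: AokiLukkarinenSpohn2006 §2 (2.8)-(2.10), BonettoLebowitzReyBellet2000 §4.1 (10), decl Literature.Barriers.AtomisticToContinuum.HeatConduction.isSteadyState_map_smul
[support] TIME-RESCALING CONJUGACY for a general chain ⟨U, V, γ⟩ and b > 0: under Φ(q, p) = (q, b·p)
(time t ↦ t/b) a steady state of ⟨U, V, γ⟩ at (T_L, T_R) pushes forward to a steady state of ⟨b²U,
b²V, bγ⟩ at (b²T_L, b²T_R), and totalCurrent scales by b³ (so D_N scales by b). Proof pattern: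
(L'f)∘Φ = b·L(f∘Φ) term by term in OscillatorChain.generator (∂_q untouched, ∂_p picks up b, ∂_qH' =
b²∂_qH at Φx, bath γ'(T'∂_p² − p'∂_p) = bγ(b²T∂_p² − bp∂_p)), bondCurrent'∘Φ = b³·bondCurrent (deriv
(b²V) = b² deriv V, also in the junk case), as in isSteadyState_map_smul / totalCurrent_map_smul of
LowTemperatureWeakAnharmonicity.lean. Provable now; with QuarticAmplitudeScaling it yields
AnchorSelfSimilarity and the η-dictionary of EtaContinuation. [difficulty: provable-now] -/
@[route_item "route-AtomisticToContinuum-ScaleFreeQuarticAnchor"]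
def TimeRescaling : Prop :=
  ∀ (U V : ℝ → ℝ) (γ b : ℝ), 0 < b → ∀ (N : ℕ) (T_L T_R : ℝ) (μ : MeasureTheory.Measure (Literature.MathematicalPhysics.KineticTheory.HeatConduction.PhaseSpace N)), (⟨U, V, γ⟩ : Literature.MathematicalPhysics.KineticTheory.HeatConduction.OscillatorChain).IsSteadyState N T_L T_R μ → (⟨fun q => b ^ 2 * U q, fun r => b ^ 2 * V r, b * γ⟩ : Literature.MathematicalPhysics.KineticTheory.HeatConduction.OscillatorChain).IsSteadyState N (b ^ 2 * T_L) (b ^ 2 * T_R) (μ.map fun x => (x.1, b • x.2)) ∧ (⟨fun q => b ^ 2 * U q, fun r => b ^ 2 * V r, b * γ⟩ : Literature.MathematicalPhysics.KineticTheory.HeatConduction.OscillatorChain).totalCurrent (μ.map fun x => (x.1, b • x.2)) = b ^ 3 * (⟨U, V, γ⟩ : Literature.MathematicalPhysics.KineticTheory.HeatConduction.OscillatorChain).totalCurrent μ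

/-- item stmt-AtomisticToContinuum-3284 · support · rank 9 · closed · moot by None · by planner
sources: AokiLukkarinenSpohn2006 §2 (2.11)-(2.13), decl Literature.Barriers.AtomisticToContinuum.HeatConduction.hasConductivity_of_smul
[support] AMPLITUDE SCALING FOR THE FOUR-COEFFICIENT QUARTIC FAMILY ⟨Aq²/2 + Lq⁴/4, Cr²/2 + Br⁴/4,
γ⟩: for s ≠ 0 a steady state of the (Ls², Bs²) chain at (T_L, T_R) pushes forward under x ↦ s • x to
a steady state of the (L, B) chain at (s²T_L, s²T_R), totalCurrent scaling by s² (D_N invariant).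
Verbatim generalisation of the PROVED isSteadyState_map_smul / totalCurrent_map_smul (which are the
case A = ω₂, C = 1) to arbitrary harmonic coefficients A, C — needed at A = C = 0 (the anchor) and
at (A, C) = (ηω₂, η) (the η-family). Provable now. [difficulty: provable-now] -/
@[route_item "route-AtomisticToContinuum-ScaleFreeQuarticAnchor"]
def QuarticAmplitudeScaling : Prop :=
  ∀ (A L C B γ s : ℝ), s ≠ 0 → ∀ (N : ℕ) (T_L T_R : ℝ) (μ : MeasureTheory.Measure (Literature.MathematicalPhysics.KineticTheory.HeatConduction.PhaseSpace N)), (⟨fun q => A * q ^ 2 / 2 + L * s ^ 2 * q ^ 4 / 4, fun r => C * r ^ 2 / 2 + B * s ^ 2 * r ^ 4 / 4, γ⟩ : Literature.MathematicalPhysics.KineticTheory.HeatConduction.OscillatorChain).IsSteadyState N T_L T_R μ → (⟨fun q => A * q ^ 2 / 2 + L * q ^ 4 / 4, fun r => C * r ^ 2 / 2 + B * r ^ 4 / 4, γ⟩ : Literature.MathematicalPhysics.KineticTheory.HeatConduction.OscillatorChain).IsSteadyState N (s ^ 2 * T_L) (s ^ 2 * T_R) (μ.map fun x => s • x) ∧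 (⟨fun q => A * q ^ 2 / 2 + L * q ^ 4 / 4, fun r => C * r ^ 2 / 2 + B * r ^ 4 / 4, γ⟩ : Literature.MathematicalPhysics.KineticTheory.HeatConduction.OscillatorChain).totalCurrent (μ.map fun x => s • x) = s ^ 2 * (⟨fun q => A * q ^ 2 / 2 + L * s ^ 2 * q ^ 4 / 4, fun r => C * r ^ 2 / 2 + B * s ^ 2 * r ^ 4 / 4, γ⟩ : Literature.MathematicalPhysics.KineticTheory.HeatConduction.OscillatorChain).totalCurrent μ

/-- item stmt-AtomisticToContinuum-3285 · support · rank 9 · closed · moot by None · by planner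
sources: AokiLukkarinenSpohn2006 §2 (2.12)-(2.13), LiLi2013 (doi:10.1103/physreve.87.042125)
[support] EXACT SELF-SIMILARITY OF THE ANCHOR (friction–temperature conjugacy): for lam, γ and s >
0, (a) FouriersLawFor ⟨lam q⁴/4, r⁴/4, γ⟩ ↔ FouriersLawFor ⟨lam q⁴/4, r⁴/4, sγ⟩, and (b) every
conductivity function κ' of the friction-γ anchor yields the conductivity function T ↦ s·κ'(T/s⁴) of
the friction-sγ anchor, i.e. D_N(T, sγ) = s·D_N(T/s⁴, γ); at s⁴ = T this is the card's identity
D_N(T, γ) = T^{1/4}·D_N(1, γT^{-1/4}) and gives κ(T) = κ(1)T^{1/4} (a LiLi2013-type power law, here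
exact). Bookkeeping: TimeRescaling with b = s maps ⟨lam q⁴/4, r⁴/4, γ⟩ at T to ⟨s²lam q⁴/4, s²r⁴/4,
sγ⟩ at s²T with D ↦ s·D, and QuarticAmplitudeScaling (A = C = 0, amplitude s) maps that to ⟨lam
q⁴/4, r⁴/4, sγ⟩ at s⁴T with D unchanged; clause (i) transfers bijectively ((T_L, T_R) ↦ (s⁴T_L,
s⁴T_R), push-forward by a measurable automorphism). So the anchor's only genuine parameter is lam (=
lam/β of the conjunct): all temperatures and all frictions are one. [deps: TimeRescaling,
QuarticAmplitudeScaling] [difficulty: provable-now] -/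
@[route_item "route-AtomisticToContinuum-ScaleFreeQuarticAnchor"]
def AnchorSelfSimilarity : Prop :=
  ∀ lam γ s : ℝ, 0 < s → ((⟨fun q => lam * q ^ 4 / 4, fun r => r ^ 4 / 4, γ⟩ : Literature.MathematicalPhysics.KineticTheory.HeatConduction.OscillatorChain).FouriersLawFor ↔ (⟨fun q => lam * q ^ 4 / 4, fun r => r ^ 4 / 4, s * γ⟩ : Literature.MathematicalPhysics.KineticTheory.HeatConduction.OscillatorChain).FouriersLawFor) ∧ ∀ κ' : ℝ → ℝ, (∀ μ : (N : ℕ) → ℝ → ℝ → MeasureTheory.Measure (Literature.MathematicalPhysics.KineticTheory.HeatConduction.PhaseSpace N), (∀ (N : ℕ) (T_L T_R : ℝ), 0 < T_L → 0 < T_R → (⟨fun q => lam * q ^ 4 / 4, fun r => r ^ 4 / 4, γ⟩ : Literature.MathematicalPhysics.KineticTheory.HeatConduction.OscillatorChain).IsSteadyState N T_L T_R (μ N T_L T_R)) → ∀ T : ℝ, 0 < T → ∃ D : ℕ → ℝ, (∀ N : ℕ, Filter.Tendsto (fun δ : ℝ => (⟨fun q => lam * q ^ 4 / 4, fun r =>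 r ^ 4 / 4, γ⟩ : Literature.MathematicalPhysics.KineticTheory.HeatConduction.OscillatorChain).totalCurrent (μ N (T + δ / 2) (T - δ / 2)) / δ) (nhdsWithin 0 {(0 : ℝ)}ᶜ) (nhds (D N))) ∧ Filter.Tendsto D Filter.atTop (nhds (κ' T))) → ∀ μ : (N : ℕ) → ℝ → ℝ → MeasureTheory.Measure (Literature.MathematicalPhysics.KineticTheory.HeatConduction.PhaseSpace N), (∀ (N : ℕ) (T_L T_R : ℝ), 0 < T_L → 0 < T_R → (⟨fun q => lam * q ^ 4 / 4, fun r => r ^ 4 / 4, s * γ⟩ : Literature.MathematicalPhysics.KineticTheory.HeatConduction.OscillatorChain).IsSteadyState N T_L T_R (μ N T_L T_R)) → ∀ T : ℝ, 0 < T → ∃ D : ℕ → ℝ, (∀ N : ℕ, Filter.Tendsto (fun δ : ℝ => (⟨fun q => lam * q ^ 4 / 4, fun r => r ^ 4 / 4, s * γ⟩ : Literature.MathematicalPhysics.KineticTheory.HeatConduction.OscillatorChain).totalCurrent (μ N (T + δ / 2) (T - δ / 2)) / δ) (nhdsWithin 0 {(0 : ℝ)}ᶜ) (nhds (D N))) ∧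 Filter.Tendsto D Filter.atTop (nhds (s * κ' (T / s ^ 4)))

/-- item stmt-AtomisticToContinuum-3286 · support · rank 9 · closed · moot by None · by planner
sources: CuneoEckmannHairerReyBellet2018 (arXiv:1712.09413) Thm 2.13, Ex. 2.5, Ex. 2.8, Rem. 2.10, decl Literature.MathematicalPhysics.KineticTheory.HeatConduction.CuneoEckmannHairerReyBellet2018_pinnedChain
[support] NESS EXISTENCE FOR THE ANCHOR (card item 2; Cuneo–Eckmann–Hairer–Rey-Bellet 2018 Thm
2.13(2) instance, print-known): for lam, γ > 0, N ≥ 1, T_L, T_R > 0 the chain ⟨lam q⁴/4, r⁴/4, γ⟩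
has a weak steady state (IsSteadyState), absolutely continuous, integrating e^{ϑH} for 0 < ϑ <
1/max(T_L, T_R) — the exact shape of the landed fact CuneoEckmannHairerReyBellet2018_pinnedChain.
Conditions: C1 (path graph controlled by its ends), C2 by Example 2.5 ('V(x) = ‖x‖^r, r = 2, 4, 6, …
is non-degenerate'; here ℓ = 3: V'''' = 6 ≠ 0 although V″(0) = 0), C3 by Example 2.8 (homogeneous of
degree 4, coercive), C4 (n = 1, Remark 2.10), C5 (ℓ_i = 4 ≥ ℓ_p = 4) — arXiv:1712.09413 pp. 4–6,
checked by the planner. The tree proof for pinnedChain (LangevinChain*.lean: Hörmander brackets via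
V″ ≠ 0, compact level sets via ω₂ > 0) must be ADAPTED (brackets of length 3 at r = 0; level sets
from lam q⁴/4). De-vacuifies AnchorFourier (HasConductivity quantifies over families defined at all
N, T_L, T_R). [difficulty: L] -/
@[route_item "route-AtomisticToContinuum-ScaleFreeQuarticAnchor"]
def AnchorSteadyStateExists : Prop :=
  ∀ lam γ : ℝ, 0 < lam → 0 < γ → ∀ (N : ℕ) (T_L T_R : ℝ), 0 < N → 0 < T_L → 0 < T_R → ∃ ν : MeasureTheory.Measure (Literature.MathematicalPhysics.KineticTheory.HeatConduction.PhaseSpace N), (⟨fun q => lam * q ^ 4 / 4, fun r => r ^ 4 / 4, γ⟩ : Literature.MathematicalPhysics.KineticTheory.HeatConduction.OscillatorChain).IsSteadyState N T_L T_R ν ∧ ν ≪ (MeasureTheory.volume : MeasureTheory.Measure (Literature.MathematicalPhysics.KineticTheory.HeatConduction.PhaseSpace N)) ∧ ∀ ϑ : ℝ, 0 < ϑ → ϑ < 1 / max T_L T_R → MeasureTheory.Integrable (fun x => Real.exp (ϑ * (⟨fun q => lam * q ^ 4 / 4, fun r => r ^ 4 / 4, γ⟩ : Literature.MathematicalPhysics.KineticTheory.HeatConduction.OscillatorChain).hamiltonian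 N x)) ν

/-- item stmt-AtomisticToContinuum-3287 · assembly · rank 1 · closed · moot by None · by planner
sources: BonettoLebowitzReyBellet2000 §5.3 (33), decl Literature.MathematicalPhysics.KineticTheory.HeatConduction.pinnedChain_exists_isSteadyState
[assembly] AnchorFourier → EtaContinuation → LowTClosure → NessUnique → FouriersLaw. Glue (planner
proof rc 0 attached as evidence, ~25 lines, axioms propext/Classical.choice/Quot.sound): fix ω₂ lam
β γ > 0; clause (i) from
Literature.MathematicalPhysics.KineticTheory.HeatConduction.pinnedChain_exists_isSteadyState
(PROVED, LangevinChainNESSHolds.lean) + NessUnique (ν = μ); clause (ii): AnchorFourier (lam/β) gives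
EtaContinuation's hypothesis, hence ∃ T₁ ∀ T > T₁ pointwise Fourier; LowTClosure gives it ∀ T > 0; κ
T := Classical.choose of the pointwise statement for T > 0 (else 1), positivity and the (∃ D,
limits) clause by choose_spec. Provers: import
Literature.MathematicalPhysics.KineticTheory.LangevinChainNESSHolds (for the existence theorem)
besides the route file. -/
@[route_item "route-AtomisticToContinuum-ScaleFreeQuarticAnchor"]
def Assembly : Prop :=
  AnchorFourier → EtaContinuation → LowTClosure → NessUnique → Literature.MathematicalPhysics.KineticTheory.HeatConduction.FouriersLaw

end Summit.AtomisticToContinuum.FouriersLaw.Theses.ScaleFreeQuarticAnchor
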